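import Summits.ValiantsHypothesis.ValiantsHypothesis.Theorems.FeketeSOSFeketeSOSHardPaleyRIPMassIdentity
import Mathlib.Algebra.BigOperators.Fin
import Mathlib.Data.Fin.Tuple.Basic

/-!
# Route FeketeSOS — crux `FeketeSOSHard` (stmt-ValiantsHypothesis-3996), line `paley-rip`:
# calibration — a representation of `F_p` by 2-sparse squares of total mass `p − 1`

`…PaleyRIPTameStatus.lean` (p576568) proves the unconditional sparse mass floor: a cyclic representation of
`F_p` by squares with `≤ m` monomials each has archimedean mass `≥ (p − 1)/m`.  This file shows the floor is
sharp up to the factor `2` at `m = 2`, and calibrates the mass scale `p^{1/2+η}` of `stub_tameReduction` /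
TameHard: the pairs-of-monomials identity `X^m = ((X^m + 1)/2)² − ((X^m − 1)/2)²` gives an EXACT
representation

  `F_p = Σ_{m<p} χ_p(m)·((X^m+1)/2)² + Σ_{m<p} (−χ_p(m))·((X^m−1)/2)²`

by `2p` weighted squares of degree `< p`, each with at most `2` monomials, of total mass
`Σ_j |c_j|·‖g_j‖₂² ≤ Σ_{m<p} |χ_p(m)| = p − 1` (`exists_twoSparse_rep`).  So the minimal mass of a 2-sparse
(cyclic or exact) representation of `F_p` lies in `[(p−1)/2, p−1]`, and "no tame representation" statements
(`mass ≤ p^{1/2+η}` impossible) can only hold for `η < 1/2`; under the engine `stub_paleyFlatRIP` they hold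
for `η < κ` on `p^{1/2+δ₁}`-sparse supports (`mass_gt_of_flatRIPAt`).

Honest framing: calibration only; the crux, the engine and `stub_tameReduction` stay OPEN; `VP ≠ VNP` untouched.
-/

set_option linter.dupNamespace false

namespace Summit.ValiantsHypothesis.ValiantsHypothesis.Theorems.FeketeSOSHardPaleyRIP

open Polynomial Finset
open scoped BigOperators

noncomputable section

section TwoSparse

variable (p : ℕ) [Fact p.Prime]

/-- `|χ_p(m)| = [m ≠ 0]` for `m < p`. [folklore] -/
theorem norm_chiC_eq {m : ℕ} (hm : m < p) :
    ‖((legendreSym p (m : ℤ) : ℤ) : ℂ)‖ = if m = 0 then 0 else 1 := by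
  have h := chiC_mul_self p hm
  have hsq : ‖((legendreSym p (m : ℤ) : ℤ) : ℂ)‖ ^ 2 = if m = 0 then 0 else 1 := by
    rw [sq, ← norm_mul, h]; split_ifs <;> simp
  have hnn : (0 : ℝ) ≤ ‖((legendreSym p (m : ℤ) : ℤ) : ℂ)‖ := norm_nonneg _
  split_ifs at hsq with h0
  · exact (pow_eq_zero_iff two_ne_zero).1 hsq |>.trans (by rw [if_pos h0])
  · rw [if_neg h0]
    nlinarith [hsq, hnn]

/-- `Σ_{m<p} |χ_p(m)| = p − 1`. [folklore] -/
theorem sum_norm_chiC : ∑ m ∈ range p, ‖((legendreSym p (m : ℤ) : ℤ) : ℂ)‖ = (p : ℝ) - 1 := by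
  rw [Finset.sum_congr rfl fun m hm => norm_chiC_eq p (mem_range.1 hm), Finset.sum_ite, Finset.sum_const_zero,
    zero_add, Finset.sum_const, nsmul_eq_mul, mul_one]
  have hp : 0 < p := (Fact.out : p.Prime).pos
  have hcard : ((range p).filter fun m => ¬ m = 0).card = p - 1 := by
    rw [Finset.filter_ne', Finset.card_erase_of_mem (mem_range.2 hp), Finset.card_range]
  rw [hcard, Nat.cast_sub hp, Nat.cast_one]

/-- The pairs-of-monomials identity `χ·((X^m+1)/2)² + (−χ)·((X^m−1)/2)² = χ·X^m`. [folklore] -/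
theorem pair_identity (χ : ℂ) (m : ℕ) :
    C χ * (C (1 / 2 : ℂ) * X ^ m + C (1 / 2 : ℂ) * X ^ 0) ^ 2 +
      C (-χ) * (C (1 / 2 : ℂ) * X ^ m + C (-(1 / 2) : ℂ) * X ^ 0) ^ 2 = C χ * X ^ m := by
  have h4 : (4 : ℂ[X]) * (C (1 / 2 : ℂ)) ^ 2 = 1 := by
    rw [← map_pow, show (4 : ℂ[X]) = C (4 : ℂ) from (map_ofNat C 4).symm, ← map_mul]
    norm_num
  rw [map_neg, map_neg]
  linear_combination (C χ * X ^ m) * h4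

/-- Mass of one square of the construction: `sqMass (±χ_p(m)) ((X^m ± 1)/2) ≤ |χ_p(m)|/2` (the `m = 0`
terms have weight `χ_p(0) = 0`). [folklore] -/
theorem sqMass_pair_le (χ : ℂ) (m : ℕ) (y : ℂ) (hy : ‖y‖ = 1 / 2) (hχ0 : m = 0 → χ = 0) :
    sqMass χ (C (1 / 2 : ℂ) * X ^ m + C y * X ^ 0) ≤ ‖χ‖ / 2 := by
  classical
  unfold sqMass
  by_cases hm : m = 0
  · rw [hχ0 hm, norm_zero, zero_mul, zero_div]
  · have hsub : (C (1 / 2 : ℂ) * X ^ m + C y * X ^ 0).support ⊆ {m, 0} := support_binomial_subset m 0 _ _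
    have hle : ∑ a ∈ (C (1 / 2 : ℂ) * X ^ m + C y * X ^ 0).support,
        ‖(C (1 / 2 : ℂ) * X ^ m + C y * X ^ 0).coeff a‖ ^ 2 ≤
        ∑ a ∈ ({m, 0} : Finset ℕ), ‖(C (1 / 2 : ℂ) * X ^ m + C y * X ^ 0).coeff a‖ ^ 2 :=
      Finset.sum_le_sum_of_subset_of_nonneg hsub fun a _ _ => sq_nonneg _
    have hval : ∑ a ∈ ({m, 0} : Finset ℕ), ‖(C (1 / 2 : ℂ) * X ^ m + C y * X ^ 0).coeff a‖ ^ 2 = 1 / 2 := by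
      rw [Finset.sum_pair hm]
      simp only [coeff_add, coeff_C_mul_X_pow, if_neg hm, if_neg (Ne.symm hm), add_zero, zero_add]
      norm_num
      rw [hy]
      norm_num
    calc ‖χ‖ * ∑ a ∈ (C (1 / 2 : ℂ) * X ^ m + C y * X ^ 0).support,
          ‖(C (1 / 2 : ℂ) * X ^ m + C y * X ^ 0).coeff a‖ ^ 2
        ≤ ‖χ‖ * (1 / 2) := by rw [← hval]; exact mul_le_mul_of_nonneg_left hle (norm_nonneg _)
      _ = ‖χ‖ / 2 := by ring

/-- **Calibration: `F_p` is an exact sum of `2p` weighted 2-sparse squares of total mass `≤ p − 1`.**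
`F_p = Σ_{m<p} χ_p(m)((X^m+1)/2)² − χ_p(m)((X^m−1)/2)²`; every square has degree `< p` and at most two
monomials, and `Σ_j |c_j|·Σ_a |g_j(a)|² ≤ p − 1`.  With `massFloor_sparse` (`m = 2`): the minimal mass of a
2-sparse cyclic representation of `F_p` lies in `[(p−1)/2, p−1]`. [folklore] -/
theorem exists_twoSparse_rep :
    ∃ (s : ℕ) (c : Fin s → ℂ) (g : Fin s → ℂ[X]),
      (∀ j, (g j).natDegree < p) ∧ (∀ j, (g j).support.card ≤ 2) ∧
      (∑ j, C (c j) * g j ^ 2) = fek p ∧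
      (∑ j, sqMass (c j) (g j)) ≤ (p : ℝ) - 1 := by
  classical
  have hp : 0 < p := (Fact.out : p.Prime).pos
  -- data: first block `χ(m), (X^m+1)/2`, second block `−χ(m), (X^m−1)/2`
  let χ : Fin p → ℂ := fun m => ((legendreSym p ((m : ℕ) : ℤ) : ℤ) : ℂ)
  let cL : Fin p → ℂ := fun m => χ m
  let cR : Fin p → ℂ := fun m => -χ m
  let gL : Fin p → ℂ[X] := fun m => C (1 / 2 : ℂ) * X ^ (m : ℕ) + C (1 / 2 : ℂ) * X ^ 0
  let gR : Fin p → ℂ[X] := fun m => C (1 / 2 : ℂ) * X ^ (m : ℕ) + C (-(1 / 2) : ℂ) * X ^ 0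
  refine ⟨p + p, Fin.append cL cR, Fin.append gL gR, ?_, ?_, ?_, ?_⟩
  · -- degrees
    have hdeg : ∀ (m : Fin p) (y : ℂ), (C (1 / 2 : ℂ) * X ^ (m : ℕ) + C y * X ^ 0).natDegree < p := by
      intro m y
      refine lt_of_le_of_lt (natDegree_add_le_of_degree_le ?_ ?_) m.isLt
      · exact natDegree_C_mul_X_pow_le _ _
      · exact (natDegree_C_mul_X_pow_le _ _).trans (Nat.zero_le _)
    intro j
    refine Fin.addCases (fun m => ?_) (fun m => ?_) j
    · simp only [Fin.append_left, gL]; exact hdeg m _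
    · simp only [Fin.append_right, gR]; exact hdeg m _
  · -- at most two monomials
    have hcard : ∀ (m : Fin p) (y : ℂ), (C (1 / 2 : ℂ) * X ^ (m : ℕ) + C y * X ^ 0).support.card ≤ 2 := by
      intro m y
      refine (Finset.card_le_card (support_binomial_subset (m : ℕ) 0 _ _)).trans ?_
      exact Finset.card_insert_le _ _ |>.trans (by simp)
    intro j
    refine Fin.addCases (fun m => ?_) (fun m => ?_) j
    · simp only [Fin.append_left, gL]; exact hcard m _
    · simp only [Fin.append_right, gR]; exact hcard m _
  · -- the identity
    rw [Fin.sum_univ_add]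
    simp only [Fin.append_left, Fin.append_right, cL, cR, gL, gR]
    rw [← Finset.sum_add_distrib, Finset.sum_congr rfl fun m _ => pair_identity (χ m) (m : ℕ)]
    unfold fek
    simp only [χ]
    rw [Fin.sum_univ_eq_sum_range (fun m => C ((legendreSym p (m : ℤ) : ℤ) : ℂ) * X ^ m) p]
  · -- the mass
    rw [Fin.sum_univ_add]
    simp only [Fin.append_left, Fin.append_right, cL, cR, gL, gR]
    have hL : ∀ m : Fin p, sqMass (χ m) (C (1 / 2 : ℂ) * X ^ (m : ℕ) + C (1 / 2 : ℂ) * X ^ 0) ≤ ‖χ m‖ / 2 :=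
      fun m => sqMass_pair_le (χ m) m _ (by norm_num) fun h0 => by
        simp only [χ, h0, Nat.cast_zero, legendreSym.at_zero, Int.cast_zero]
    have hR : ∀ m : Fin p, sqMass (-χ m) (C (1 / 2 : ℂ) * X ^ (m : ℕ) + C (-(1 / 2) : ℂ) * X ^ 0) ≤ ‖χ m‖ / 2 :=
      fun m => (sqMass_pair_le (-χ m) m _ (by norm_num) fun h0 => by
        simp only [χ, h0, Nat.cast_zero, legendreSym.at_zero, Int.cast_zero, neg_zero]).trans
          (by rw [norm_neg])
    calc ∑ m : Fin p, sqMass (χ m) (C (1 / 2 : ℂ) * X ^ (m : ℕ) + C (1 / 2 : ℂ) * X ^ 0) +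
          ∑ m : Fin p, sqMass (-χ m) (C (1 / 2 : ℂ) * X ^ (m : ℕ) + C (-(1 / 2) : ℂ) * X ^ 0)
        ≤ ∑ m : Fin p, ‖χ m‖ / 2 + ∑ m : Fin p, ‖χ m‖ / 2 :=
          add_le_add (sum_le_sum fun m _ => hL m) (sum_le_sum fun m _ => hR m)
      _ = ∑ m : Fin p, ‖χ m‖ := by rw [← Finset.sum_add_distrib]; exact sum_congr rfl fun m _ => by ring
      _ = (p : ℝ) - 1 := by
          simp only [χ]
          rw [Fin.sum_univ_eq_sum_range (fun m => ‖((legendreSym p (m : ℤ) : ℤ) : ℂ)‖) p]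
          exact sum_norm_chiC p

end TwoSparse

end

end Summit.ValiantsHypothesis.ValiantsHypothesis.Theorems.FeketeSOSHardPaleyRIP
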